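import Mathlib
import Summits.ABC.ABC.Theorems.ThreeSlotOneSlot
import Summits.ABC.ABC.Theorems.ThreeSlotZooEvenPowerRung

/-!
# `ZooSorting`, one-slot cell with `c` a prime power (birth stub `stub_oneSlot_primePow`)

Support for `ZooSorting` (stmt-ABC-24024) on `route-ABC-ThreeSlotCyclotomicDescent`: the abc triples
`1 + b = c` with `ω(bc) ≤ 3` and `c = r^z` a prime power are sorted ε-free:

* `z = 1`: `c` is prime, `c ≤ rad`;
* `ω(b) ≤ 1` (`b = p^x`): `x = 1` gives `c = p + 1 ≤ 5 · rad`; `x, z ≥ 2` is `8 + 1 = 9` by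
  Mihăilescu's theorem (`mihailescu_holds`, proved in the tree);
* `ω(b) = 2`, `b = p^x q^y`:
  * `z` even: `c ≤ 5 · rad` by `ThreeSlotOneSlot.fourPow_le_five_rad` (`r = 2`) and
    `ThreeSlotZooEvenPowerRung.zooEvenPowerRung` (`r` odd, so `p = 2`);
  * `z` odd `≥ 3`, `r = 2`: wall family W2a (`2^z − 1 = p^x q^y`);
  * `z` odd `≥ 3`, `r` odd (so `b = 2^x q^y`): `y = 1` gives `c ≤ 5 · rad`
    (`ThreeSlotOneSlot.oddExp_le_five_rad`), `y = 2` is the solved family L3 (Nagell–Ljunggren with a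
    square), `y ≥ 3` is the wall W1 (Nagell–Ljunggren, `y ≥ 3`).

The conclusion lists exactly the disjuncts of the route statement that occur (with `a = 1` dropped);
the assembly file places them.
-/

-- `Summit.<Summit>.<Problem>` is the mandated summit-side namespace (CONVENTIONS §2); for the
-- single-conjunct summit `ABC` the two coincide, so the duplicate `ABC.ABC` is deliberate.
set_option linter.dupNamespace false

namespace Summit.ABC.ABC.Theorems.ThreeSlotOneSlotPrimePow

open Literature.NumberTheory.DiophantineGeometry (IsABCTriple rad rad_def mihailescu_holds)
open UniqueFactorizationMonoid (radical dvd_radical_iff_of_irreducible)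
open Summit.ABC.ABC.Theorems.ThreeSlotOneSlot (exists_eq_pow_mul_pow_of_card_primeFactors_eq_two
  fourPow_le_five_rad oddExp_le_five_rad)
open Summit.ABC.ABC.Theorems.ThreeSlotZooEvenPowerRung (zooEvenPowerRung)
open Summit.ABC.ABC.Theorems.UniformSadicTowerFour.ThreeSlotWall (primeFactors_abc_eq_union')

/-- A prime `p` dividing `b` satisfies `p ≤ rad(1 · b · c)` (`b, c > 0`). [folklore] -/
theorem le_rad_of_prime_dvd {p b c : ℕ} (hb : 0 < b) (hc : 0 < c) (hp : p.Prime) (hpb : p ∣ b) :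
    p ≤ rad 1 b c := by
  have hn : 1 * b * c ≠ 0 := by positivity
  rw [rad_def]
  exact Nat.le_of_dvd (Nat.radical_pos _)
    ((dvd_radical_iff_of_irreducible hp.prime.irreducible hn).mpr
      (dvd_mul_of_dvd_left (dvd_mul_of_dvd_right hpb _) _))

/-- A prime `c` of a triple `(1, b, c)` with `b > 0` satisfies `c ≤ rad(1 · b · c)`. [folklore] -/
theorem le_rad_of_prime {b c : ℕ} (hb : 0 < b) (hc : c.Prime) : c ≤ rad 1 b c := by
  have hn : 1 * b * c ≠ 0 := by have := hc.pos; positivity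
  rw [rad_def]
  exact Nat.le_of_dvd (Nat.radical_pos _)
    ((dvd_radical_iff_of_irreducible hc.prime.irreducible hn).mpr (dvd_mul_left c _))

/-- For an abc triple `(1, b, c)`: `ω(1 · b · c) = ω(b) + ω(c)`. [folklore] -/
theorem card_primeFactors_one_mul {b c : ℕ} (h : IsABCTriple 1 b c) :
    (1 * b * c).primeFactors.card = b.primeFactors.card + c.primeFactors.card := by
  obtain ⟨hU, hD⟩ := primeFactors_abc_eq_union' h
  rw [hU, Finset.card_union_of_disjoint hD, one_mul]

/-- If `r` is odd and `1 + p^x q^y = r^z` with `p < q` primes, then `p = 2`. [folklore] -/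
theorem eq_two_of_odd {p q x y r z : ℕ} (hp : p.Prime) (hq : q.Prime) (hpq : p < q)
    (hr : Odd r) (h : 1 + p ^ x * q ^ y = r ^ z) : p = 2 := by
  have h2 : 2 ∣ p ^ x * q ^ y := by
    obtain ⟨k, hk⟩ : Odd (r ^ z) := hr.pow
    exact ⟨k, by omega⟩
  rcases (Nat.Prime.dvd_mul Nat.prime_two).1 h2 with h2 | h2
  · exact ((Nat.prime_dvd_prime_iff_eq Nat.prime_two hp).1 (Nat.prime_two.dvd_of_dvd_pow h2)).symm
  · have hq2 : 2 = q :=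
      (Nat.prime_dvd_prime_iff_eq Nat.prime_two hq).1 (Nat.prime_two.dvd_of_dvd_pow h2)
    have := hp.two_le
    omega

/-- **One-slot cell with `ω(b) ≤ 1` and `c = r^z`, `z ≥ 2`**: `c ≤ 5 · rad(1 · b · c)` — either
`b = p` is prime (`c = p + 1 ≤ 2p`) or, by Mihăilescu's theorem, `(b, c) = (8, 9)`. [folklore] -/
theorem le_five_rad_of_card_le_one {b r z : ℕ} (ht : IsABCTriple 1 b (r ^ z)) (hr : r.Prime)
    (hz : 2 ≤ z) (hωb : b.primeFactors.card ≤ 1) : r ^ z ≤ 5 * rad 1 b (r ^ z) := by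
  have hb0 : 0 < b := ht.2.1
  have hc0 : 0 < r ^ z := pow_pos hr.pos z
  have hsum : 1 + b = r ^ z := ht.2.2.1
  have hrad1 : 1 ≤ rad 1 b (r ^ z) := by rw [rad_def]; exact Nat.radical_pos _
  rcases Nat.lt_or_ge b.primeFactors.card 1 with h0 | h1
  · -- `b = 1`, `c = 2`
    have hb1 : b.primeFactors = ∅ := Finset.card_eq_zero.mp (by omega)
    rcases Nat.primeFactors_eq_empty.mp hb1 with rfl | rfl
    · omega
    · omega
  · -- `b = p^x`
    have h1' : b.primeFactors.card = 1 := le_antisymm hωb h1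
    obtain ⟨p, x, hp, hx, hpx⟩ :=
      (isPrimePow_nat_iff _).mp (isPrimePow_iff_card_primeFactors_eq_one.mpr h1')
    have hple : p ≤ rad 1 b (r ^ z) :=
      le_rad_of_prime_dvd hb0 hc0 hp (by rw [← hpx]; exact dvd_pow_self p hx.ne')
    rcases Nat.lt_or_ge x 2 with hx1 | hx2
    · -- `x = 1`: `c = p + 1`
      have hx1' : x = 1 := by omega
      subst hx1'
      rw [pow_one] at hpx
      omega
    · -- `x, z ≥ 2`: Mihăilescu, `(b, c) = (8, 9)`
      obtain ⟨rfl, rfl, rfl, rfl⟩ :=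
        mihailescu_holds (x := r) (y := p) (a := z) (b := x) hp.pos hz hx2 (by omega)
      have h3 : 3 ≤ rad 1 b (3 ^ 2) := by
        have hn : 1 * b * 3 ^ 2 ≠ 0 := by positivity
        rw [rad_def]
        exact Nat.le_of_dvd (Nat.radical_pos _)
          ((dvd_radical_iff_of_irreducible Nat.prime_three.prime.irreducible hn).mpr
            (Dvd.dvd.mul_left (by norm_num) _))
      omega

/-- **One-slot cell, `c` a prime power** (birth stub `stub_oneSlot_primePow` of `ZooSorting`): an abc
triple `(1, b, c)` with `ω(bc) ≤ 3` and `c` a prime power has `c ≤ 5 · rad`, or is in the solved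
family L3 (`1 + 2^x q² = r^z`, `r, z` odd, `z ≥ 3`), or in the wall W1 (`1 + 2^x q^y = r^z`, `r, z`
odd, `z ≥ 3`, `y ≥ 3`), or in the wall W2a (`2^z − 1 = p^x q^y`, `z` odd `≥ 3`). [folklore] -/
theorem oneSlot_primePow : ∀ b c : ℕ, IsABCTriple 1 b c → (1 * b * c).primeFactors.card ≤ 3 →
    IsPrimePow c →
    c ≤ 5 * rad 1 b c ∨
    (∃ x q r z : ℕ, q.Prime ∧ r.Prime ∧ Odd r ∧ Odd z ∧ 3 ≤ z ∧ b = 2 ^ x * q ^ 2 ∧ c = r ^ z) ∨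
    (∃ x y q r z : ℕ, q.Prime ∧ r.Prime ∧ Odd r ∧ Odd z ∧ 3 ≤ z ∧ 3 ≤ y ∧ b = 2 ^ x * q ^ y ∧
      c = r ^ z) ∨
    (∃ x y z p q : ℕ, p.Prime ∧ q.Prime ∧ p ≠ q ∧ 1 ≤ x ∧ 1 ≤ y ∧ Odd z ∧ 3 ≤ z ∧
      b = p ^ x * q ^ y ∧ c = 2 ^ z) := by
  intro b c ht hω hc
  have hb0 : 0 < b := ht.2.1
  have hsum : 1 + b = c := ht.2.2.1
  obtain ⟨r, z, hr, hz, hrz⟩ := (isPrimePow_nat_iff _).mp hc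
  -- `z = 1`: `c` is prime
  rcases Nat.lt_or_ge z 2 with hz1 | hz2
  · left
    have hz1' : z = 1 := by omega
    subst hz1'
    rw [pow_one] at hrz
    subst hrz
    have := le_rad_of_prime hb0 hr
    omega
  -- `ω(b) ≤ 2`
  have hcard := card_primeFactors_one_mul ht
  have hωc : c.primeFactors.card = 1 := by
    rw [← hrz, Nat.primeFactors_prime_pow hz.ne' hr, Finset.card_singleton]
  have hωb : b.primeFactors.card ≤ 2 := by omega
  rcases Nat.lt_or_ge b.primeFactors.card 2 with hωb1 | hωb2
  · -- `ω(b) ≤ 1`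
    left
    subst hrz
    exact le_five_rad_of_card_le_one ht hr hz2 (by omega)
  -- `b = p^x q^y`
  have hωb2' : b.primeFactors.card = 2 := le_antisymm hωb hωb2
  obtain ⟨p, q, x, y, hp, hq, hpq, hx, hy, hb⟩ :=
    exists_eq_pow_mul_pow_of_card_primeFactors_eq_two hωb2'
  have hpq' : p ≠ q := hpq.ne
  have h : 1 + p ^ x * q ^ y = r ^ z := by rw [← hb, hrz]; exact hsum
  rcases Nat.even_or_odd z with ⟨m, hm⟩ | hzo
  · -- `z` even
    left
    have hm2 : z = 2 * m := by omega
    have hm1 : 1 ≤ m := by omega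
    rcases hr.eq_two_or_odd' with rfl | hro
    · -- `r = 2`: `1 + p^x q^y = 4^m`
      have h' : 1 + p ^ x * q ^ y = 2 ^ (2 * m) := by rw [← hm2]; exact h
      have := fourPow_le_five_rad p q x y m hp hq hpq' hx hy h'
      rw [hb, ← hrz, hm2]
      exact this
    · -- `r` odd: `p = 2`
      have hp2 : p = 2 := eq_two_of_odd hp hq hpq hro h
      subst hp2
      have h' : 1 + 2 ^ x * q ^ y = r ^ (2 * m) := by rw [← hm2]; exact h
      have := zooEvenPowerRung x y q r m hq hr hy hm1 h'
      rw [hb, ← hrz, hm2]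
      exact this
  · -- `z` odd, hence `z ≥ 3`
    have hz3 : 3 ≤ z := by rcases hzo with ⟨k, hk⟩; omega
    rcases hr.eq_two_or_odd' with rfl | hro
    · -- `r = 2`: wall W2a
      right; right; right
      exact ⟨x, y, z, p, q, hp, hq, hpq', hx, hy, hzo, hz3, hb, hrz.symm⟩
    · -- `r` odd: `b = 2^x q^y`
      have hp2 : p = 2 := eq_two_of_odd hp hq hpq hro h
      subst hp2
      have hr2 : r ≠ 2 := by rintro rfl; exact absurd hro (by decide)
      have hrodd : Odd r := hr.odd_of_ne_two hr2
      rcases Nat.lt_or_ge y 3 with hy3 | hy3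
      · rcases Nat.lt_or_ge y 2 with hy2 | hy2
        · -- `y = 1`: `c ≤ q r ≤ rad`
          left
          have hy1 : y = 1 := by omega
          subst hy1
          rw [pow_one] at h hb
          have := oddExp_le_five_rad x q r z hq hr hr2 hzo h
          rw [hb, ← hrz]
          exact this
        · -- `y = 2`: solved family L3
          right; left
          have hy2' : y = 2 := by omega
          subst hy2'
          exact ⟨x, q, r, z, hq, hr, hrodd, hzo, hz3, hb, hrz.symm⟩
      · -- `y ≥ 3`: wall W1
        right; right; left
        exact ⟨x, y, q, r, z, hq, hr, hrodd, hzo, hz3, hy3, hb, hrz.symm⟩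

end Summit.ABC.ABC.Theorems.ThreeSlotOneSlotPrimePow
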